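import Summits.KontsevichZagierPeriods.KontsevichZagierPeriods.Theorems.RootDecompRationalCubeDichotomyEtaleRootIsolation

/-!
# Route RootDecompRationalCubeDichotomy — items 29429 `PiRationalisationEtale` / 29431 `PiRationalisationGlue` PROVED, part 4/8: S1 with a generic numerator — `green_rectN` (Green on one rectangle band for `h = N/F`) and `outerGreenE_holds` (`RootDecompRationalCubeDichotomyEtaleOuterGreen`)

Theorems-split (≤ 400 lines each, sequential imports) of the decomp-kz lens-2 gen-5 file
`run/shared/lean/pub/decomp-kz/decomp-kz-lens-2/g5/PiRationalisationEtale.lean` (sha256 204f4992…, 2557 lines; lens farm rc 0 / 0 sorry /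
std axioms; critic decomp-kz-crit-1 g2 CLEARED/CONFIRMED 2026-08-30T06:50:50Z «29429 + 29431 proved BY NAME»), landed by the census seat
decomp-kz-census-1 g6 with the 86 verbatim copies of already-landed declarations REMOVED in favour of `import`/`open` of the landed
`Rung27842.ReIm` / `Rung27842.SimpleBranch` / `Rung24903` chain (`ratCubeSet`, `piIter_mem_sup`, `RatBoxSet`, `BoxRescale`, `boxRescale_holds`,
the Re–Im polynomial calculus, the Green assembly kit, the S3/S1 lemmas), so that only the NEW weighted (étale) content is declared here.
The rung: for WEIGHTED simple-branch (standard-étale) data `[Π[loᵢ,hiᵢ], A(x,h x)/B(x,h x)]` (`F(x,h) = 0`, `∂_w F(x,h) ≠ 0`, `B(x,h) ≠ 0` on the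
closed box, `F A B ∈ ℚ[x,w]`, `h` ℚ-Nash near the box) `[π]^K·[s] ∈ relations ⊔ ⟨rational closed-cube sector⟩` for every `K ≥ 1` — the gen-4
argument-principle chain with the contour form `ω = A·F_w/(B·F) dw`, whose residue at the simple real root is `A/B = s.integrand`.
[Kontsevich–Zagier 2001 §1.2; argument principle] Standard axioms, 0 sorry.
-/

noncomputable section

set_option linter.dupNamespace false

namespace Summit.KontsevichZagierPeriods.RootDecompRationalCubeDichotomy.RungEtale.Etale

open MeasureTheory Set MvPolynomial
open Literature.NumberTheory.Transcendental Literature.NumberTheory.Transcendental.KZ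
open Literature.ModelTheory.ExponentialFields (IsSemialgebraic analyticOnNhd_aeval continuous_aeval_real)
open Summit.KontsevichZagierPeriods.KontsevichZagierPeriods.Theses.RootDecompRationalCubeDichotomy
open Summit.KontsevichZagierPeriods.RootDecompRationalCubeDichotomy.Rung24903 (of_sub_of_mem_relations_of_fibreMap)
open Summit.KontsevichZagierPeriods.RootDecompRationalCubeDichotomy.Rung27842
open Summit.KontsevichZagierPeriods.RootDecompRationalCubeDichotomy.Rung27842.RootIso
open Summit.KontsevichZagierPeriods.RootDecompRationalCubeDichotomy.Rung27842.SimpleBranch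
open Summit.KontsevichZagierPeriods.RootDecompRationalCubeDichotomy.Rung24903
  (piRep_mul_mem_sup_of_mem_closure piRep_mul_mem_sup piIter_mem_sup isSemialgebraic_cubeLit)

/-- `x ↦ (x, φ x)` is continuous on `s` where `φ` is. -/
theorem continuousOn_graphMap {m : ℕ} {φ : (Fin m → ℝ) → ℝ} {s : Set (Fin m → ℝ)} (hφ : ContinuousOn φ s) :
    ContinuousOn (fun y : Fin m → ℝ => (Fin.snoc y (φ y) : Fin (m + 1) → ℝ)) s := by
  refine continuousOn_pi.2 fun j => ?_
  refine Fin.lastCases ?_ (fun i => ?_) j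
  · simp only [Fin.snoc_last]; exact hφ
  · simp only [Fin.snoc_castSucc]; exact (continuous_apply i).continuousOn

/-- **Green on one rectangle band** for `h = N / F` (generic numerator): given the base data and `F ≠ 0` on the closed
rectangle band, the two boundary representations exist and `[bQ] − [bP] ∈ relations`. -/
theorem green_rectN {n : ℕ} {τ : Set (Fin n → ℝ)} (_hτs : IsSemialgebraic ℚ τ) (hτc : IsCompact τ)
    (N F : MvPolynomial (Fin (n + 1)) ℚ) {α β γ δ : (Fin n → ℝ) → ℝ}
    (hα : IsSemialgebraicFunOn ℚ τ α) (hβ : IsSemialgebraicFunOn ℚ τ β)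
    (hγ : IsSemialgebraicFunOn ℚ τ γ) (hδ : IsSemialgebraicFunOn ℚ τ δ)
    (hαc : ContinuousOn α τ) (hβc : ContinuousOn β τ) (hγc : ContinuousOn γ τ) (hδc : ContinuousOn δ τ)
    (hαβ : ∀ x ∈ τ, α x ≤ β x) (hγδ : ∀ x ∈ τ, γ x ≤ δ x)
    (hFne : ∀ w ∈ KZlog.band (KZlog.band τ α β) (fun y => γ (Fin.init y)) (fun y => δ (Fin.init y)),
      aeval (ReIm.cplxPoint w) F ≠ 0) :
    ∃ bP bQ : IntegralRep (n + 1),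
      bP.domain = KZlog.band τ α β ∧
      (∀ y ∈ bP.domain, bP.integrand y =
        ReIm.ratIm (N) F (Fin.snoc y (δ (Fin.init y))) -
          ReIm.ratIm (N) F (Fin.snoc y (γ (Fin.init y)))) ∧
      bQ.domain = KZlog.band τ γ δ ∧
      (∀ y ∈ bQ.domain, bQ.integrand y =
        ReIm.ratRe (N) F (Fin.snoc (Fin.snoc (Fin.init y) (β (Fin.init y)) : Fin (n + 1) → ℝ) (y (Fin.last n))) -
          ReIm.ratRe (N) F (Fin.snoc (Fin.snoc (Fin.init y) (α (Fin.init y)) : Fin (n + 1) → ℝ) (y (Fin.last n)))) ∧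
      of bQ - of bP ∈ relations := by
  -- the region
  have hSab : IsSemialgebraic ℚ (KZlog.band τ α β) := KZlog.isSemialgebraic_band hα hβ
  have hSγδ : IsSemialgebraic ℚ (KZlog.band τ γ δ) := KZlog.isSemialgebraic_band hγ hδ
  have hSabc : IsCompact (KZlog.band τ α β) := isCompact_band hτc hαc hβc
  have hSγδc : IsCompact (KZlog.band τ γ δ) := isCompact_band hτc hγc hδc
  have hγ' : IsSemialgebraicFunOn ℚ (KZlog.band τ α β) (fun y => γ (Fin.init y)) :=
    hγ.comp_init_mono hSab KZ.band_subset_setOf_init_mem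
  have hδ' : IsSemialgebraicFunOn ℚ (KZlog.band τ α β) (fun y => δ (Fin.init y)) :=
    hδ.comp_init_mono hSab KZ.band_subset_setOf_init_mem
  have hα' : IsSemialgebraicFunOn ℚ (KZlog.band τ γ δ) (fun y => α (Fin.init y)) :=
    hα.comp_init_mono hSγδ KZ.band_subset_setOf_init_mem
  have hβ' : IsSemialgebraicFunOn ℚ (KZlog.band τ γ δ) (fun y => β (Fin.init y)) :=
    hβ.comp_init_mono hSγδ KZ.band_subset_setOf_init_mem
  have hcA : ∀ {S : Set (Fin (n + 1) → ℝ)}, S ⊆ {z | Fin.init z ∈ τ} →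
      ∀ {φ : (Fin n → ℝ) → ℝ}, ContinuousOn φ τ → ContinuousOn (fun y : Fin (n + 1) → ℝ => φ (Fin.init y)) S :=
    fun hS φ hφ => hφ.comp continuous_init'.continuousOn fun z hz => hS hz
  have hγc' := hcA (S := KZlog.band τ α β) KZ.band_subset_setOf_init_mem hγc
  have hδc' := hcA (S := KZlog.band τ α β) KZ.band_subset_setOf_init_mem hδc
  have hαc' := hcA (S := KZlog.band τ γ δ) KZ.band_subset_setOf_init_mem hαc
  have hβc' := hcA (S := KZlog.band τ γ δ) KZ.band_subset_setOf_init_mem hβc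
  have hRs : IsSemialgebraic ℚ (KZlog.band (KZlog.band τ α β) (fun y => γ (Fin.init y)) (fun y => δ (Fin.init y))) :=
    KZlog.isSemialgebraic_band hγ' hδ'
  have hRc : IsCompact (KZlog.band (KZlog.band τ α β) (fun y => γ (Fin.init y)) (fun y => δ (Fin.init y))) :=
    isCompact_band hSabc hγc' hδc'
  -- edge points lie in the region
  have memV : ∀ y ∈ KZlog.band τ α β, ∀ t ∈ Icc (γ (Fin.init y)) (δ (Fin.init y)),
      (Fin.snoc y t : Fin (n + 2) → ℝ) ∈
        KZlog.band (KZlog.band τ α β) (fun y => γ (Fin.init y)) (fun y => δ (Fin.init y)) :=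
    fun y hy t ht => KZlog.snoc_mem_band.2 ⟨hy, ht⟩
  have memH : ∀ y ∈ KZlog.band τ γ δ, ∀ s ∈ Icc (α (Fin.init y)) (β (Fin.init y)),
      (Fin.snoc (Fin.snoc (Fin.init y) s : Fin (n + 1) → ℝ) (y (Fin.last n)) : Fin (n + 2) → ℝ) ∈
        KZlog.band (KZlog.band τ α β) (fun y => γ (Fin.init y)) (fun y => δ (Fin.init y)) := by
    intro y hy s hs
    refine KZlog.snoc_mem_band.2 ⟨KZlog.snoc_mem_band.2 ⟨hy.1, hs⟩, ?_⟩
    simpa using And.intro hy.2.1 hy.2.2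
  have hDδ : ∀ y ∈ KZlog.band τ α β, aeval (ReIm.cplxPoint (Fin.snoc y (δ (Fin.init y)) : Fin (n + 2) → ℝ)) F ≠ 0 :=
    fun y hy => hFne _ (memV y hy _ ⟨hγδ _ hy.1, le_rfl⟩)
  have hDγ : ∀ y ∈ KZlog.band τ α β, aeval (ReIm.cplxPoint (Fin.snoc y (γ (Fin.init y)) : Fin (n + 2) → ℝ)) F ≠ 0 :=
    fun y hy => hFne _ (memV y hy _ ⟨le_rfl, hγδ _ hy.1⟩)
  have hDβ : ∀ y ∈ KZlog.band τ γ δ, aeval (ReIm.cplxPoint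
      (Fin.snoc (Fin.snoc (Fin.init y) (β (Fin.init y)) : Fin (n + 1) → ℝ) (y (Fin.last n)) : Fin (n + 2) → ℝ)) F ≠ 0 :=
    fun y hy => hFne _ (memH y hy _ ⟨hαβ _ hy.1, le_rfl⟩)
  have hDα : ∀ y ∈ KZlog.band τ γ δ, aeval (ReIm.cplxPoint
      (Fin.snoc (Fin.snoc (Fin.init y) (α (Fin.init y)) : Fin (n + 1) → ℝ) (y (Fin.last n)) : Fin (n + 2) → ℝ)) F ≠ 0 :=
    fun y hy => hFne _ (memH y hy _ ⟨le_rfl, hαβ _ hy.1⟩)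
  have hDden : ∀ w ∈ KZlog.band (KZlog.band τ α β) (fun y => γ (Fin.init y)) (fun y => δ (Fin.init y)),
      aeval (ReIm.cplxPoint w) (ReIm.dDen F) ≠ 0 := by
    intro w hw; simp only [ReIm.dDen, map_mul]; exact mul_ne_zero (hFne w hw) (hFne w hw)
  -- the three representations
  let rW : IntegralRep (n + 2) := cRep _ hRs hRc (ReIm.ratRe (ReIm.dNum N F) (ReIm.dDen F))
    (ReIm.isSemialgebraicFunOn_ratRe _ _ hRs hDden) (ReIm.continuousOn_ratRe _ _ hDden)
  let bP : IntegralRep (n + 1) := cRep _ hSab hSabc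
    (fun y => ReIm.ratIm N F (Fin.snoc y (δ (Fin.init y))) - ReIm.ratIm N F (Fin.snoc y (γ (Fin.init y))))
    (IsSemialgebraicFunOn.sub_holds (sa_Im N F hSab hδ' hDδ) (sa_Im N F hSab hγ' hDγ))
    ((co_Im N F hδc' hDδ).sub (co_Im N F hγc' hDγ))
  let bQ : IntegralRep (n + 1) := cRep _ hSγδ hSγδc
    (fun y => ReIm.ratRe N F (Fin.snoc (Fin.snoc (Fin.init y) (β (Fin.init y)) : Fin (n + 1) → ℝ) (y (Fin.last n))) -
      ReIm.ratRe N F (Fin.snoc (Fin.snoc (Fin.init y) (α (Fin.init y)) : Fin (n + 1) → ℝ) (y (Fin.last n))))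
    (IsSemialgebraicFunOn.sub_holds (sa_Re N F hSγδ hβ' hDβ) (sa_Re N F hSγδ hα' hDα))
    ((co_Re N F hβc' hDβ).sub (co_Re N F hαc' hDα))
  refine ⟨bP, bQ, rfl, fun y _ => rfl, rfl, fun y _ => rfl, ?_⟩
  exact ReIm.of_sub_of_mem_relations_green_rat N F hα hβ hγ hδ hαβ hγδ rW bP bQ rfl
    (fun w hw => hFne w hw) (fun _ _ => rfl) rfl (fun _ _ => rfl) rfl (fun _ _ => rfl)

/-- **S1-E `OuterGreenE` HOLDS** (PROVED: Green (`ReIm.of_sub_of_mem_relations_green_rat`) on the three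
rectangle bands `T = [a,b]×[ε,c]`, `LL = [a,g−ε]×[0,ε]`, `LR = [g+ε,b]×[0,ε]` where `F ≠ 0` by `IsolatedOn`, one constant
fibre split of the outer vertical edge at `v = ε`, two function-cut fibre splits of the level-`ε` horizontal edge at
`u = g ∓ ε` (common graphs are null), integrand additivity, and `Im h = 0` on the real axis). -/
theorem outerGreenE_holds : OuterGreenE := by
  intro n g U piece N F lo hi a b c ε hU hsub hg han hlohi hdom hiso
  have hab : (a:ℝ) < b := by exact_mod_cast hiso.1
  have hε : (0:ℝ) < ε := by exact_mod_cast hiso.2.1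
  have hεc : (ε:ℝ) < c := by exact_mod_cast hiso.2.2.1
  have hc : (0:ℝ) < c := hε.trans hεc
  have hmarg := hiso.2.2.2.1
  have hτc : IsCompact piece.domain := by rw [hdom]; exact isCompact_univ_pi fun _ => isCompact_Icc
  have hτs : IsSemialgebraic ℚ piece.domain := piece.isSemialgebraic_domain
  have hgτ : IsSemialgebraicFunOn ℚ piece.domain g := hg.mono hsub hτs
  have hgc : ContinuousOn g piece.domain := fun x hx => (han x (hsub hx)).continuousAt.continuousWithinAt
  -- bound functions
  have hKa : IsSemialgebraicFunOn ℚ piece.domain (fun _ => (a:ℝ)) := isSemialgebraicFunOn_ratCast hτs a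
  have hKb : IsSemialgebraicFunOn ℚ piece.domain (fun _ => (b:ℝ)) := isSemialgebraicFunOn_ratCast hτs b
  have hKc : IsSemialgebraicFunOn ℚ piece.domain (fun _ => (c:ℝ)) := isSemialgebraicFunOn_ratCast hτs c
  have hKε : IsSemialgebraicFunOn ℚ piece.domain (fun _ => (ε:ℝ)) := isSemialgebraicFunOn_ratCast hτs ε
  have hK0 : IsSemialgebraicFunOn ℚ piece.domain (fun _ => (0:ℝ)) :=
    (isSemialgebraicFunOn_ratCast hτs 0).congr (fun _ _ => by simp)
  have hgm : IsSemialgebraicFunOn ℚ piece.domain (fun x => g x - ε) := IsSemialgebraicFunOn.sub_holds hgτ hKε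
  have hgp : IsSemialgebraicFunOn ℚ piece.domain (fun x => g x + ε) := IsSemialgebraicFunOn.add_holds hgτ hKε
  have hgmc : ContinuousOn (fun x => g x - (ε:ℝ)) piece.domain := hgc.sub continuousOn_const
  have hgpc : ContinuousOn (fun x => g x + (ε:ℝ)) piece.domain := hgc.add continuousOn_const
  have cc : ∀ r : ℝ, ContinuousOn (fun _ : Fin n → ℝ => r) piece.domain := fun r => continuousOn_const
  -- non-vanishing of `F` on the three regions
  have hne : ∀ w : Fin (n + 2) → ℝ, Fin.init (Fin.init w) ∈ piece.domain →
      (a:ℝ) ≤ Fin.init w (Fin.last n) → Fin.init w (Fin.last n) ≤ (b:ℝ) →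
      |w (Fin.last (n + 1))| ≤ (c:ℝ) →
      ¬ (Fin.init w (Fin.last n) = g (Fin.init (Fin.init w)) ∧ w (Fin.last (n + 1)) = 0) →
      aeval (ReIm.cplxPoint w) F ≠ 0 := by
    intro w hx ha hb hv hnot
    rw [eq_snoc_snoc w]
    exact aeval_cplxPoint_ne_zero_of_isolated hiso hx ha hb hv hnot
  have hFT : ∀ w ∈ KZlog.band (KZlog.band piece.domain (fun _ => (a:ℝ)) (fun _ => (b:ℝ)))
      (fun y => (fun _ : Fin n → ℝ => (ε:ℝ)) (Fin.init y)) (fun y => (fun _ : Fin n → ℝ => (c:ℝ)) (Fin.init y)),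
      aeval (ReIm.cplxPoint w) F ≠ 0 := by
    intro w hw
    obtain ⟨hx, ⟨h1, h2⟩, ⟨h3, h4⟩⟩ := (mem_band_band_iff w).1 hw
    refine hne w hx h1 h2 (by rw [abs_of_pos (hε.trans_le h3)]; exact h4) ?_
    rintro ⟨-, h0⟩; rw [h0] at h3; exact absurd h3 (not_le.2 hε)
  have hFLL : ∀ w ∈ KZlog.band (KZlog.band piece.domain (fun _ => (a:ℝ)) (fun x => g x - ε))
      (fun y => (fun _ : Fin n → ℝ => (0:ℝ)) (Fin.init y)) (fun y => (fun _ : Fin n → ℝ => (ε:ℝ)) (Fin.init y)),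
      aeval (ReIm.cplxPoint w) F ≠ 0 := by
    intro w hw
    obtain ⟨hx, ⟨h1, h2⟩, ⟨h3, h4⟩⟩ := (mem_band_band_iff w).1 hw
    have hm := hmarg _ hx
    refine hne w hx h1 (by linarith [hm.2]) (by rw [abs_of_nonneg h3]; exact h4.trans hεc.le) ?_
    rintro ⟨h0, -⟩; rw [h0] at h2; linarith
  have hFLR : ∀ w ∈ KZlog.band (KZlog.band piece.domain (fun x => g x + ε) (fun _ => (b:ℝ)))
      (fun y => (fun _ : Fin n → ℝ => (0:ℝ)) (Fin.init y)) (fun y => (fun _ : Fin n → ℝ => (ε:ℝ)) (Fin.init y)),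
      aeval (ReIm.cplxPoint w) F ≠ 0 := by
    intro w hw
    obtain ⟨hx, ⟨h1, h2⟩, ⟨h3, h4⟩⟩ := (mem_band_band_iff w).1 hw
    have hm := hmarg _ hx
    refine hne w hx (by linarith [hm.1]) h2 (by rw [abs_of_nonneg h3]; exact h4.trans hεc.le) ?_
    rintro ⟨h0, -⟩; rw [h0] at h1; linarith
  -- three Green applications
  obtain ⟨bPT, bQT, hbPTd, hbPTi, hbQTd, hbQTi, gT⟩ := green_rectN hτs hτc N F hKa hKb hKε hKc (cc _) (cc _) (cc _) (cc _)
    (fun _ _ => hab.le) (fun _ _ => hεc.le) hFT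
  obtain ⟨bPL, bQL, hbPLd, hbPLi, hbQLd, hbQLi, gL⟩ := green_rectN hτs hτc N F hKa hgm hK0 hKε (cc _) hgmc (cc _) (cc _)
    (fun x hx => by linarith [(hmarg x hx).1]) (fun _ _ => hε.le) hFLL
  obtain ⟨bPR, bQR, hbPRd, hbPRi, hbQRd, hbQRi, gR⟩ := green_rectN hτs hτc N F hgp hKb hK0 hKε hgpc (cc _) (cc _) (cc _)
    (fun x hx => by linarith [(hmarg x hx).2]) (fun _ _ => hε.le) hFLR
  -- edge non-vanishing facts for the output / intermediate representations
  have hS0ε : IsSemialgebraic ℚ (KZlog.band piece.domain (fun _ => (0:ℝ)) (fun _ => (ε:ℝ))) :=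
    KZlog.isSemialgebraic_band hK0 hKε
  have hS0c : IsSemialgebraic ℚ (KZlog.band piece.domain (fun _ => (0:ℝ)) (fun _ => (c:ℝ))) :=
    KZlog.isSemialgebraic_band hK0 hKc
  have hSab : IsSemialgebraic ℚ (KZlog.band piece.domain (fun _ => (a:ℝ)) (fun _ => (b:ℝ))) :=
    KZlog.isSemialgebraic_band hKa hKb
  have hSgg : IsSemialgebraic ℚ (KZlog.band piece.domain (fun x => g x - ε) (fun x => g x + ε)) :=
    KZlog.isSemialgebraic_band hgm hgp
  have hS0εc : IsCompact (KZlog.band piece.domain (fun _ => (0:ℝ)) (fun _ => (ε:ℝ))) := isCompact_band hτc (cc _) (cc _)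
  have hS0cc : IsCompact (KZlog.band piece.domain (fun _ => (0:ℝ)) (fun _ => (c:ℝ))) := isCompact_band hτc (cc _) (cc _)
  have hSabc : IsCompact (KZlog.band piece.domain (fun _ => (a:ℝ)) (fun _ => (b:ℝ))) := isCompact_band hτc (cc _) (cc _)
  have hSggc : IsCompact (KZlog.band piece.domain (fun x => g x - ε) (fun x => g x + ε)) := isCompact_band hτc hgmc hgpc
  have sub0 : ∀ {S : Set (Fin (n + 1) → ℝ)} {α β : (Fin n → ℝ) → ℝ}, S = KZlog.band piece.domain α β →
      S ⊆ {z | Fin.init z ∈ piece.domain} := fun h => h ▸ KZ.band_subset_setOf_init_mem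
  -- semialgebraic / continuous edge parameter functions on the (n+1)-dim bands
  have saK : ∀ {S : Set (Fin (n + 1) → ℝ)}, IsSemialgebraic ℚ S → ∀ q : ℚ, IsSemialgebraicFunOn ℚ S (fun _ => (q:ℝ)) :=
    fun hS q => isSemialgebraicFunOn_ratCast hS q
  have saGp : ∀ {S : Set (Fin (n + 1) → ℝ)}, IsSemialgebraic ℚ S → S ⊆ {z | Fin.init z ∈ piece.domain} →
      IsSemialgebraicFunOn ℚ S (fun y => g (Fin.init y) + (ε:ℝ)) :=
    fun hS hSs => hgp.comp_init_mono hS hSs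
  have saGm : ∀ {S : Set (Fin (n + 1) → ℝ)}, IsSemialgebraic ℚ S → S ⊆ {z | Fin.init z ∈ piece.domain} →
      IsSemialgebraicFunOn ℚ S (fun y => g (Fin.init y) - (ε:ℝ)) :=
    fun hS hSs => hgm.comp_init_mono hS hSs
  have coGp : ∀ {S : Set (Fin (n + 1) → ℝ)}, S ⊆ {z | Fin.init z ∈ piece.domain} →
      ContinuousOn (fun y : Fin (n + 1) → ℝ => g (Fin.init y) + (ε:ℝ)) S :=
    fun hSs => hgpc.comp continuous_init'.continuousOn fun z hz => hSs hz
  have coGm : ∀ {S : Set (Fin (n + 1) → ℝ)}, S ⊆ {z | Fin.init z ∈ piece.domain} →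
      ContinuousOn (fun y : Fin (n + 1) → ℝ => g (Fin.init y) - (ε:ℝ)) S :=
    fun hSs => hgmc.comp continuous_init'.continuousOn fun z hz => hSs hz
  have coK : ∀ {S : Set (Fin (n + 1) → ℝ)} (r : ℝ), ContinuousOn (fun _ : Fin (n + 1) → ℝ => r) S :=
    fun r => continuousOn_const
  -- F ≠ 0 at the edge points used below
  have hD_E1p : ∀ y ∈ KZlog.band piece.domain (fun _ => (0:ℝ)) (fun _ => (ε:ℝ)), aeval (ReIm.cplxPoint
      (Fin.snoc (Fin.snoc (Fin.init y) (g (Fin.init y) + (ε:ℝ)) : Fin (n + 1) → ℝ) (y (Fin.last n)) : Fin (n + 2) → ℝ)) F ≠ 0 := by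
    rintro y ⟨hx, h1, h2⟩
    have hm := hmarg _ hx
    refine aeval_cplxPoint_ne_zero_of_isolated hiso hx (by linarith [hm.1]) (by linarith [hm.2])
      (by rw [abs_of_nonneg h1]; exact h2.trans hεc.le) ?_
    rintro ⟨h0, -⟩; linarith
  have hD_E1m : ∀ y ∈ KZlog.band piece.domain (fun _ => (0:ℝ)) (fun _ => (ε:ℝ)), aeval (ReIm.cplxPoint
      (Fin.snoc (Fin.snoc (Fin.init y) (g (Fin.init y) - (ε:ℝ)) : Fin (n + 1) → ℝ) (y (Fin.last n)) : Fin (n + 2) → ℝ)) F ≠ 0 := by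
    rintro y ⟨hx, h1, h2⟩
    have hm := hmarg _ hx
    refine aeval_cplxPoint_ne_zero_of_isolated hiso hx (by linarith [hm.1]) (by linarith [hm.2])
      (by rw [abs_of_nonneg h1]; exact h2.trans hεc.le) ?_
    rintro ⟨h0, -⟩; linarith
  have hD_b : ∀ {γ' δ' : ℝ}, 0 ≤ γ' → δ' ≤ (c:ℝ) → ∀ y ∈ KZlog.band piece.domain (fun _ => γ') (fun _ => δ'),
      aeval (ReIm.cplxPoint (Fin.snoc (Fin.snoc (Fin.init y) (b:ℝ) : Fin (n + 1) → ℝ) (y (Fin.last n)) : Fin (n + 2) → ℝ)) F ≠ 0 := by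
    rintro γ' δ' h0 hc' y ⟨hx, h1, h2⟩
    have hm := hmarg _ hx
    refine aeval_cplxPoint_ne_zero_of_isolated hiso hx hab.le le_rfl
      (by rw [abs_of_nonneg (h0.trans h1)]; exact h2.trans hc') ?_
    rintro ⟨h0, -⟩; linarith
  have hD_a : ∀ {γ' δ' : ℝ}, 0 ≤ γ' → δ' ≤ (c:ℝ) → ∀ y ∈ KZlog.band piece.domain (fun _ => γ') (fun _ => δ'),
      aeval (ReIm.cplxPoint (Fin.snoc (Fin.snoc (Fin.init y) (a:ℝ) : Fin (n + 1) → ℝ) (y (Fin.last n)) : Fin (n + 2) → ℝ)) F ≠ 0 := by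
    rintro γ' δ' h0 hc' y ⟨hx, h1, h2⟩
    have hm := hmarg _ hx
    refine aeval_cplxPoint_ne_zero_of_isolated hiso hx le_rfl hab.le
      (by rw [abs_of_nonneg (h0.trans h1)]; exact h2.trans hc') ?_
    rintro ⟨h0, -⟩; linarith
  have hD_top : ∀ {α' β' : (Fin n → ℝ) → ℝ} {t : ℝ}, 0 < t → t ≤ (c:ℝ) → (∀ x ∈ piece.domain, (a:ℝ) ≤ α' x) →
      (∀ x ∈ piece.domain, β' x ≤ (b:ℝ)) → ∀ y ∈ KZlog.band piece.domain α' β',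
      aeval (ReIm.cplxPoint (Fin.snoc y t : Fin (n + 2) → ℝ)) F ≠ 0 := by
    rintro α' β' t ht htc hαa hβb y ⟨hx, h1, h2⟩
    rw [← Fin.snoc_init_self y]
    refine aeval_cplxPoint_ne_zero_of_isolated hiso hx ((hαa _ hx).trans h1) (h2.trans (hβb _ hx))
      (by rw [abs_of_pos ht]; exact htc) ?_
    rintro ⟨-, h0⟩; exact ht.ne' h0
  -- the output representations
  let E1 : IntegralRep (n + 1) := cRep _ hS0ε hS0εc
    (fun y => ReIm.ratRe N F (Fin.snoc (Fin.snoc (Fin.init y) (g (Fin.init y) + (ε:ℝ)) : Fin (n + 1) → ℝ) (y (Fin.last n))) -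
      ReIm.ratRe N F (Fin.snoc (Fin.snoc (Fin.init y) (g (Fin.init y) - (ε:ℝ)) : Fin (n + 1) → ℝ) (y (Fin.last n))))
    (IsSemialgebraicFunOn.sub_holds (sa_Re N F hS0ε (saGp hS0ε (sub0 rfl)) hD_E1p) (sa_Re N F hS0ε (saGm hS0ε (sub0 rfl)) hD_E1m))
    ((co_Re N F (coGp (sub0 rfl)) hD_E1p).sub (co_Re N F (coGm (sub0 rfl)) hD_E1m))
  have hE1d : E1.domain = KZlog.band piece.domain (fun _ => (0:ℝ)) (fun _ => (ε:ℝ)) := rfl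
  have hD_E2 := hD_top (α' := fun x => g x - ε) (β' := fun x => g x + ε) hε hεc.le
    (fun x hx => by linarith [(hmarg x hx).1]) (fun x hx => by linarith [(hmarg x hx).2])
  let E2 : IntegralRep (n + 1) := cRep _ hSgg hSggc (fun y => ReIm.ratIm N F (Fin.snoc y (ε:ℝ)))
    (sa_Im N F hSgg (saK hSgg ε) hD_E2) (co_Im N F (coK _) hD_E2)
  have hE2d : E2.domain = KZlog.band piece.domain (fun x => g x - ε) (fun x => g x + ε) := rfl
  let BQ : IntegralRep (n + 1) := cRep _ hS0c hS0cc
    (fun y => ReIm.ratRe N F (Fin.snoc (Fin.snoc (Fin.init y) (b:ℝ) : Fin (n + 1) → ℝ) (y (Fin.last n))) -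
      ReIm.ratRe N F (Fin.snoc (Fin.snoc (Fin.init y) (a:ℝ) : Fin (n + 1) → ℝ) (y (Fin.last n))))
    (IsSemialgebraicFunOn.sub_holds (sa_Re N F hS0c (saK hS0c b) (hD_b le_rfl le_rfl))
      (sa_Re N F hS0c (saK hS0c a) (hD_a le_rfl le_rfl)))
    ((co_Re N F (coK _) (hD_b le_rfl le_rfl)).sub (co_Re N F (coK _) (hD_a le_rfl le_rfl)))
  have hBQd : BQ.domain = KZlog.band piece.domain (fun _ => (0:ℝ)) (fun _ => (c:ℝ)) := rfl
  have hD_BP := hD_top (α' := fun _ => (a:ℝ)) (β' := fun _ => (b:ℝ)) hc le_rfl (fun _ _ => le_rfl) (fun _ _ => le_rfl)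
  let BP : IntegralRep (n + 1) := cRep _ hSab hSabc (fun y => ReIm.ratIm N F (Fin.snoc y (c:ℝ)))
    (sa_Im N F hSab (saK hSab c) hD_BP) (co_Im N F (coK _) hD_BP)
  have hBPd : BP.domain = KZlog.band piece.domain (fun _ => (a:ℝ)) (fun _ => (b:ℝ)) := rfl
  -- intermediate representations
  let S : IntegralRep (n + 1) := cRep _ hS0ε hS0εc
    (fun y => ReIm.ratRe N F (Fin.snoc (Fin.snoc (Fin.init y) (b:ℝ) : Fin (n + 1) → ℝ) (y (Fin.last n))) -
      ReIm.ratRe N F (Fin.snoc (Fin.snoc (Fin.init y) (g (Fin.init y) - (ε:ℝ)) : Fin (n + 1) → ℝ) (y (Fin.last n))))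
    (IsSemialgebraicFunOn.sub_holds (sa_Re N F hS0ε (saK hS0ε b) (hD_b le_rfl hεc.le))
      (sa_Re N F hS0ε (saGm hS0ε (sub0 rfl)) hD_E1m))
    ((co_Re N F (coK _) (hD_b le_rfl hεc.le)).sub (co_Re N F (coGm (sub0 rfl)) hD_E1m))
  have hSd : S.domain = KZlog.band piece.domain (fun _ => (0:ℝ)) (fun _ => (ε:ℝ)) := rfl
  have hD_M := hD_top (α' := fun _ => (a:ℝ)) (β' := fun _ => (b:ℝ)) hε hεc.le (fun _ _ => le_rfl) (fun _ _ => le_rfl)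
  let M : IntegralRep (n + 1) := cRep _ hSab hSabc (fun y => ReIm.ratIm N F (Fin.snoc y (ε:ℝ)))
    (sa_Im N F hSab (saK hSab ε) hD_M) (co_Im N F (coK _) hD_M)
  have hMd : M.domain = KZlog.band piece.domain (fun _ => (a:ℝ)) (fun _ => (b:ℝ)) := rfl
  -- relations
  -- r1: split BQ at v = ε
  obtain ⟨BQ₁, BQ₂, hBQ₁d, hBQ₁i, hBQ₂d, hBQ₂i, r1⟩ := fibre_split BQ (τ := piece.domain) (α := fun _ => (0:ℝ))
    (μ := fun _ => (ε:ℝ)) (β := fun _ => (c:ℝ)) hBQd hK0 hKε hKc (fun _ _ => hε.le) (fun _ _ => hεc.le)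
  -- r2: BQ₂ ≡ bQT
  have r2 : of BQ₂ - of bQT ∈ relations :=
    of_sub_of_mem_relations_of_eqOn (hbQTd.trans hBQ₂d.symm) fun z hz => by
      rw [hBQ₂i, hbQTi z (by rw [hbQTd]; rw [hBQ₂d] at hz; exact hz)]; rfl
  -- r3a: BQ₁ = bQL + S ; r3b: S = bQR + E1
  have r3a : of BQ₁ - of bQL - of S ∈ relations := by
    refine rel_add BQ₁ bQL S (hbQLd.trans hBQ₁d.symm) (hSd.trans hBQ₁d.symm) fun z hz => ?_
    rw [hBQ₁i, hbQLi z (by rw [hbQLd]; rw [hBQ₁d] at hz; exact hz)]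
    show _ - _ = _ - _ + (_ - _); ring
  have r3b : of S - of bQR - of E1 ∈ relations := by
    refine rel_add S bQR E1 (hbQRd.trans hSd.symm) (hE1d.trans hSd.symm) fun z hz => ?_
    rw [hbQRi z (by rw [hbQRd]; rw [hSd] at hz; exact hz)]
    show _ - _ = _ - _ + (_ - _); ring
  -- r6: BP = bPT + M
  have r6 : of BP - of bPT - of M ∈ relations := by
    refine rel_add BP bPT M (hbPTd.trans hBPd.symm) (hMd.trans hBPd.symm) fun z hz => ?_
    rw [hbPTi z (by rw [hbPTd]; rw [hBPd] at hz; exact hz)]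
    show ReIm.ratIm N F (Fin.snoc z (c:ℝ)) = _ - _ + ReIm.ratIm N F (Fin.snoc z (ε:ℝ)); ring
  -- r7, r8: split M at u = g - ε and u = g + ε
  obtain ⟨M₁, M₂₃, hM₁d, hM₁i, hM₂₃d, hM₂₃i, r7⟩ := fibre_split M (τ := piece.domain) (α := fun _ => (a:ℝ))
    (μ := fun x => g x - ε) (β := fun _ => (b:ℝ)) hMd hKa hgm hKb
    (fun x hx => by linarith [(hmarg x hx).1]) (fun x hx => by linarith [(hmarg x hx).2])
  obtain ⟨M₂, M₃, hM₂d, hM₂i, hM₃d, hM₃i, r8⟩ := fibre_split M₂₃ (τ := piece.domain) (α := fun x => g x - ε)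
    (μ := fun x => g x + ε) (β := fun _ => (b:ℝ)) hM₂₃d hgm hgp hKb
    (fun x hx => by linarith) (fun x hx => by linarith [(hmarg x hx).2])
  -- r9: M₁ ≡ bPL, r10: M₃ ≡ bPR (bottom edge `v = 0` carries the zero integrand), r11: M₂ ≡ E2
  have r9 : of M₁ - of bPL ∈ relations :=
    of_sub_of_mem_relations_of_eqOn (hbPLd.trans hM₁d.symm) fun z hz => by
      rw [hM₁i, hbPLi z (by rw [hbPLd]; rw [hM₁d] at hz; exact hz)]
      show ReIm.ratIm N F (Fin.snoc z (ε:ℝ)) = ReIm.ratIm N F (Fin.snoc z (ε:ℝ)) - ReIm.ratIm N F (Fin.snoc z 0)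
      rw [ReIm.ratIm_snoc_zero, sub_zero]
  have r10 : of M₃ - of bPR ∈ relations :=
    of_sub_of_mem_relations_of_eqOn (hbPRd.trans hM₃d.symm) fun z hz => by
      rw [hM₃i, hM₂₃i, hbPRi z (by rw [hbPRd]; rw [hM₃d] at hz; exact hz)]
      show ReIm.ratIm N F (Fin.snoc z (ε:ℝ)) = ReIm.ratIm N F (Fin.snoc z (ε:ℝ)) - ReIm.ratIm N F (Fin.snoc z 0)
      rw [ReIm.ratIm_snoc_zero, sub_zero]
  have r11 : of M₂ - of E2 ∈ relations :=
    of_sub_of_mem_relations_of_eqOn (hE2d.trans hM₂d.symm) fun z hz => by rw [hM₂i, hM₂₃i]; rfl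
  -- assemble
  refine ⟨E1, E2, BQ, BP, ⟨hE1d, fun _ _ => rfl⟩, ⟨hE2d, fun _ _ => rfl⟩, ⟨hBQd, fun _ _ => rfl⟩, ⟨hBPd, fun _ _ => rfl⟩, ?_⟩
  have key : of E1 - of E2 - (of BQ - of BP) =
      -(of BQ - of BQ₁ - of BQ₂) - (of BQ₂ - of bQT) - (of BQ₁ - of bQL - of S) - (of S - of bQR - of E1)
      + (of BP - of bPT - of M) + (of M - of M₁ - of M₂₃) + (of M₂₃ - of M₂ - of M₃)
      + (of M₁ - of bPL) + (of M₃ - of bPR) + (of M₂ - of E2)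
      - (of bQL - of bPL) - (of bQR - of bPR) - (of bQT - of bPT) := by abel
  rw [key]
  refine sub_mem (sub_mem (sub_mem (add_mem (add_mem (add_mem (add_mem (add_mem (add_mem
    (sub_mem (sub_mem (sub_mem (neg_mem r1) r2) r3a) r3b) r6) r7) r8) r9) r10) r11) gL) gR) gT

end Summit.KontsevichZagierPeriods.RootDecompRationalCubeDichotomy.RungEtale.Etale
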